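import Literature.Analysis.FluidPDE.GKPCompactnessPathSpace
import Literature.Analysis.FluidPDE.BesovMildWeak
import Literature.Analysis.FluidPDE.CurlFreeLiouville
import HarnessLib

/-!
# GKP Proposition 2.3 (rigidity of critical elements): the statement over GKP's class, and the
# model-independent steps of its printed proof

Analysis/FluidPDE proof file (theorems only: no definition, no named fact) next to
`Literature/Analysis/FluidPDE/GKPCriticalElements.lean`, around Gallagher–Koch–Planchon 2016,
**Prop. 2.3** — "if `u₀ ∈ Ḃ^{s_p}_{p,p}` with
`sup_{t ∈ [0,T*(u₀))} ‖NS(u₀)(t)‖_{Ḃ^{s_p}_{p,p}} < ∞` and `NS(u₀)(t) → 0` in `𝓢'` as `t ↗ T*(u₀)`,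
then `T*(u₀) = ∞`" (arXiv:1407.4156, §2.1 p. 6). That file used to vendor it as a named fact
`gkp_rigidity` for the tree's class `IsBesovMildSolutionOn` (duality-form mild solution,
`C([0,T); Ḃ^{s_p}_{p,p})` through its distributions, Kato's class `K_∞`) and the tree's maximality
`IsMaximalBesovMildSolution` (no extension in that class); this file is the outcome of the attempt
to *discharge* that fact, and the sibling of `GKPRegularityPersistence.lean` ((1.9) with (1.6)),
`GKPCriticalElementsPathSpace.lean` (Prop. 2.1) and `GKPCompactnessPathSpace.lean` (Prop. 2.2),
which do the same for the other three GKP statements.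

**Verdict (2026-08-15, prove seat).** The tree-class rendering was **mis-stated**: in print (pp. 4,
6, 9) Prop. 2.3 and its proof concern `u := NS(u₀)`, the unique solution of (1.2) in
`𝓛^{1:∞}_p[T < T*]`, and its maximal time in that class (§2.5 applies Prop. 2.8 "to `u = NS(u₀)`
and `T* = T*(u₀)`"), whereas the rendering took its hypothesis over the tree's class
`IsBesovMildSolutionOn` and its conclusion over `IsMaximalBesovMildSolution`; it is the printed
statement plus the unprinted identification `hId` of the two classes (`gkp_rigidity_of_pathSpace`
below). The two phrasings of the faithful statement (the wanted named fact `gkp_rigidity_pathSpace`;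
unbundled: `IsBesovMildSolutionOn ∧ MemGKPPathSpace`, conclusion "a GKP extension exists"; bundled:
`IsGKPSolutionOn`, conclusion `¬ IsMaximalGKPSolution`) are identified by
`gkp_rigidity_pathSpace_iff_exists_extension` below.

**Review of the decomposition (2026-08-15, D-0026).** The named fact `gkp_rigidity` was then
**retired and merged back into the proof obligation of its parent** `gkp_besov_blowup` (GKP Thm. 1,
`CriticalRegularity.lean`): besides being mis-stated, it is Step 3 of the printed proof *by
contradiction* of Thm. 1 (§2.1: "Theorem 1 is an immediate corollary of" Props. 2.1–2.3), its own
proof (§2.5) is a theory (Prop. 2.8 = the iteration of §§4–5 in the path spaces, ε-regularity,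
backward uniqueness, unique continuation, suitability of `NS(u₀)`), and over one and the same class
it is a **corollary of the parent**: `gkp_rigidity_of_gkp_besov_blowup`
(`GKPCriticalElementsProofs.lean`, tree classes) and `gkp_rigidity_pathSpace_of_blowup_pathSpace`
(`GKPCriticalElements.lean`, GKP's class) — `limsup ≤ sup`. Its statement (the tree rendering)
survives verbatim as an explicit hypothesis of the §2.1 architecture theorems
(`limsup_eq_top_of_isGKPExponent`, `gkp_besov_blowup_of_criticalElements`,
`gkp_besov_blowup_of_gkp`) and as the conclusion of `gkp_rigidity_of_pathSpace` below and of
`gkp_rigidity_of_gkp_besov_blowup`.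

## What is printed (arXiv:1407.4156, p. 6 and §2.5 p. 9)

Prop. 2.3 is a statement about `NS(u₀)`, the unique solution of (1.2) in GKP's path space
`𝓛^{1:∞}_p[T < T*]` ((1.3), (1.5), (1.6)), and about its maximal time `T*(u₀)` in that space. Its
proof (§2.5, "relies crucially on the 'improved bounds via iteration' results presented and proved
in Sections 4 and 5", p. 6) runs: Prop. 2.8 (positive regularity at blow-up, §§4–5) gives
`‖u‖_{L³(Q_{ε,R}(x))} → 0` and, by Calderón–Zygmund, `‖π‖_{L^{3/2}(Q_{ε,R}(x))} → 0` as `|x| → ∞`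
near `T*`; `u` is smooth on `ℝ³ × (0, T*)` ((1.6)) and `(u, π)` is a suitable weak solution, so
ε-regularity makes `u` smooth and bounded up to `t = T*` outside a compact `K`; since
`NS(u₀)(t) → 0` in `𝓢'`, *"`NS(u₀)(T*)` is well-defined outside of `K`, and hence
`NS(u₀)(x, T*) ≡ 0` for all `x ∈ Kᶜ`"* (Step C below); backward uniqueness and unique continuation
for `ω = ∇ ∧ NS(u₀)` (Escauriaza–Seregin–Šverák, as in Kenig–Koch 2011) give `NS(u₀)(·, t) ≡ 0`
for some (indeed every) `t ∈ (0, T*)`; *"therefore `T*(u₀) = +∞` by small data results"* (the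
endgame below).

## What this file proves

* `gkp_rigidity_of_pathSpace : hP → hId → (Prop. 2.3 in the tree's rendering)` — the former
  vendored fact is Prop. 2.3 transported to GKP's own class (`MemGKPPathSpace`, hypothesis `hP`)
  **plus** the identification `hId` of the tree's class with `NS(u₀)` ("every
  `IsBesovMildSolutionOn` solution lies in `𝓛^{1:∞}[T' < T]`"), the unprinted ingredient audited in
  `GKPRegularityPersistence.lean` (Kato's `K_∞` supplies no `L²`-in-time integrability at `t = 0`;
  continuity in the critical Besov space alone is not a uniqueness class, Fujii 2026, Thm. 1.2);
  and the capstone `gkp_besov_blowup_of_pathSpace`: GKP's Theorem 1 as rendered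
  (`gkp_besov_blowup`) follows from (1.9)+(1.6), Props. 2.1, 2.2, 2.3 over GKP's class and `hId`,
  by the accepted assembly `gkp_besov_blowup_of_gkp`; and
  `gkp_rigidity_pathSpace_iff_exists_extension`: `hP` is the faithful Prop. 2.3 in the bundled
  vocabulary of `GKPCriticalElements.lean`
  (`IsGKPSolutionOn … → sup < ∞ → U t → 0 → ¬ IsMaximalGKPSolution …`, the conclusion of
  `gkp_rigidity_pathSpace_of_blowup_pathSpace` there);
* the **endgame** of §2.5 in the tree's rendering, unconditionally: the zero pair is a Besov mild
  solution on every `[0, T)` (`isBesovMildSolutionOn_zero`), so a pair whose slices vanish a.e. on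
  `[0, T)` — or whose distributions vanish on `[0, T)` — is not maximal with lifespan `T`
  (`not_isMaximalBesovMildSolution_of_forall_ae_eq_zero`,
  `IsBesovMildSolutionOn.not_isMaximalBesovMildSolution_of_forall_eq_zero`), and already so when
  the slices vanish a.e. for `0 < t < T` only, in the classes `-2 < s < 0`, `1 ≤ q` (the missing
  time `t = 0` follows by continuity of the pairings, BCD Prop. 2.27:
  `ContinuousInHomBesovOn.apply_zero_eq_zero_of_forall_Ioo`,
  `IsBesovMildSolutionOn.not_isMaximalBesovMildSolution_of_forall_Ioo_ae_eq_zero`): "`u(·, t) ≡ 0`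
  … therefore `T* = ∞`";
* **Step C** of §2.5, unconditionally and model-independently: if `U i → 0` in `𝓢'` along a
  filter, `U i` is (eventually) the distribution of the field `u i`, and the fields converge against
  smooth compactly supported tests inside an open `Ω` to a locally integrable `w`, then `w = 0` a.e.
  on `Ω` (`ae_eq_zero_on_of_tendsto_temperedDistribution_zero`); in particular for the slices of a
  Besov mild solution as `t ↑ T` (`IsBesovMildSolutionOn.limit_ae_eq_zero_on`); and the
  plug-in form with locally uniform convergence to a continuous limit, which then vanishes
  identically on `Ω` (`tendsto_integral_smul_of_tendstoLocallyUniformlyOn`,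
  `eqOn_zero_of_tendsto_temperedDistribution_zero`, `IsBesovMildSolutionOn.limit_eqOn_zero`);
* **Step E** of §2.5 ("backward uniqueness and unique continuation for `ω` imply
  `NS(u₀)(·, t) ≡ 0`"), unconditionally: the low-frequency cut-offs fix the distribution of a
  constant field (`lowFreqCutoff_eq_self_of_isDistributionOf_const`, via `∫ 𝓕 h = h(0)`,
  `integral_fourier_eq_apply_zero`), so the realisation clause of `MemHomBesov` excludes non-zero
  constants (`eq_zero_of_isDistributionOf_const_of_tendsto_lowFreqCutoff`,
  `eq_zero_of_isDistributionOf_const_of_memHomBesov`), and with the tree's Liouville theorem for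
  `curl V = 0`, `div V = 0` (`eq_of_curl_eq_zero_of_isDivFree_of_bounded`, `CurlFreeLiouville`):
  a bounded `C²` slice with vanishing curl and divergence whose distribution lies in some
  `Ḃ^s_{p,q}` is identically zero (`eq_zero_of_curl_eq_zero_of_isDivFree_of_memHomBesov`).

Nothing in the sibling files changes; no statement of the tree is weakened; the remaining steps of
§2.5 (Prop. 2.8, suitability and ε-regularity near `T*` outside a compact, backward uniqueness and
unique continuation for the vorticity) are the named facts of other files
(`ess_backward_uniqueness`, `ess_unique_continuation`, `ckn_epsilon_regularity`,
`ess_associated_pressure`, `knss2009_local_smoothing` — all discharged in the tree by now: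
`ESSBackwardUniquenessHolds.lean`, `ESSUniqueContinuationHolds.lean`,
`CKNEpsilonRegularityAssemblyProofs.lean`, `NSSuitableESSPressureProofs.lean`,
`KNSSLocalSmoothingHolds.lean`) or not yet in the tree (Prop. 2.8, §§4–5: Thm. 4, Prop. 4.2 and the
invertibility lemmas of §5 in the Kato/path spaces; the bridge "mild solution in
`𝓛^{1:∞}_p[T < T*]` with the local `L³ × L^{3/2}` decay ⟹ suitable weak solution, regular near `T*`
outside a compact", Kenig–Koch 2011, to which §2.5 refers).

## References

* I. Gallagher, G. S. Koch, F. Planchon, *Blow-up of critical Besov norms at a potential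
  Navier–Stokes singularity*, Comm. Math. Phys. 343 (2016) 39–82 = arXiv:1407.4156: §2.1 p. 6
  (Prop. 2.3), §2.5 p. 9 (its proof), p. 4 ((1.2), (1.3), (1.5), (1.6)). [cite: GKP2016, Prop. 2.3]
* C. E. Kenig, G. S. Koch, *An alternative approach to regularity for the Navier–Stokes equations
  in critical spaces*, Ann. Inst. H. Poincaré Anal. Non Linéaire 28 (2011) 159–187, §§2–3 (the
  rigidity argument GKP refer to). [cite: GKP2016, §2.5]
* M. Fujii, *Sharp non-uniqueness for the Navier–Stokes equations in scaling critical spaces*,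
  arXiv:2602.19846 (2026), Thm. 1.2, Rem. 1.3. [cite: Fujii2026, Thm. 1.2]
* G. Koch, N. Nadirashvili, G. Seregin, V. Šverák, *Liouville theorems for the Navier–Stokes
  equations and applications*, Acta Math. 203 (2009) 83–105, Lemma 3.1 (Liouville for
  `curl z = 0`, `div z = 0`). [cite: KochNadirashviliSereginSverak2009, Lemma 3.1]
* H. Bahouri, J.-Y. Chemin, R. Danchin, *Fourier Analysis and Nonlinear PDE* (2011), Def. 1.26
  (`𝓢'_h`), Prop. 2.27. [cite: BahouriCheminDanchin2011, Def. 1.26]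
-/

noncomputable section

open MeasureTheory TemperedDistribution Set Function Filter
open _root_.Topology
open scoped SchwartzMap ENNReal NNReal

namespace Literature.Analysis.FluidPDE

/-! ## The endgame of §2.5: vanishing slices extend by zero -/

section Zero

variable {ι : Type*} [Fintype ι]

/-- **The zero field is a duality-form mild solution** of the unforced Navier–Stokes equations on
any time set, from the zero datum (every pairing in the identity of Fabes–Jones–Rivière 1972,
Thm. 2.1 vanishes; the zero field is weakly divergence free). [folklore] -/
theorem isMildNSSolutionOn_zero (S : Set ℝ) (ν : ℝ) :
    IsMildNSSolutionOn S ν (0 : ℝ → EuclideanSpace ℝ ι → EuclideanSpace ℝ ι) 0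
      (0 : ℝ → EuclideanSpace ℝ ι → EuclideanSpace ℝ ι) := by
  refine ⟨fun t _ θ _ => by simp, fun t _ φ _ _ => by simp⟩

/-- **The zero pair is a Besov mild solution on every `[0, T)`**, in every class `(s, p, q)` and
for every viscosity: the trivial solution `NS(0) = 0` with `T*(0) = ∞` (GKP 2016, §1, small data;
here all five clauses of `IsBesovMildSolutionOn` are checked directly: the duality identity is
`0 = 0`, the zero distribution represents the zero field, `0 ∈ Ḃ^s_{p,q}` with constant (zero)
Besov distance, and `√t ‖0‖_∞ = 0`). [cite: GKP2016, §1] -/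
theorem isBesovMildSolutionOn_zero (s : ℝ) (p q : ℝ≥0∞) [Fact (1 ≤ p)] (T ν : ℝ) :
    IsBesovMildSolutionOn s p q T ν (0 : ℝ → EuclideanSpace ℝ ι → EuclideanSpace ℝ ι)
      (0 : ℝ → 𝓢'(EuclideanSpace ℝ ι, EuclideanSpace ℂ ι)) where
  mild := isMildNSSolutionOn_zero (Ico 0 T) ν
  aestronglyMeasurable := aestronglyMeasurable_const
  isDistributionOf _ _ := isDistributionOf_zero
  continuousInHomBesovOn :=
    ⟨fun _ _ => FunctionSpaces.memHomBesov_zero s p q, fun _ _ => by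
      simpa using tendsto_const_nhds⟩
  memKatoClassOn := ⟨fun _ _ => by simp, by simp⟩

variable {s : ℝ} {p q : ℝ≥0∞} [Fact (1 ≤ p)] {T ν : ℝ}
  {u : ℝ → EuclideanSpace ℝ ι → EuclideanSpace ℝ ι}
  {U : ℝ → 𝓢'(EuclideanSpace ℝ ι, EuclideanSpace ℂ ι)}

/-- **Endgame of GKP §2.5 ("`NS(u₀)(·, t) ≡ 0` … therefore `T*(u₀) = +∞`"), in the tree's
rendering.** If every slice `u t`, `t ∈ [0, T)`, vanishes a.e., then `(u, U)` is not a maximal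
Besov mild solution with lifespan `T`: the zero pair on `[0, T + 1)` (`isBesovMildSolutionOn_zero`)
extends it in the class. [cite: GKP2016, §2.5] -/
theorem not_isMaximalBesovMildSolution_of_forall_ae_eq_zero
    (h0 : ∀ t ∈ Ico 0 T, u t =ᵐ[volume] 0) : ¬ IsMaximalBesovMildSolution s p q T ν u U :=
  fun hmax => hmax.not_extendable
    ⟨T + 1, by linarith, 0, 0, isBesovMildSolutionOn_zero s p q (T + 1) ν,
      fun t ht => (h0 t ht).symm⟩

/-- **Endgame of GKP §2.5, distributional form.** If the distributions `U t`, `t ∈ [0, T)`, of a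
Besov mild solution `(u, U)` on `[0, T)` all vanish, then `(u, U)` is not maximal with lifespan
`T`: a field is determined a.e. by its tempered distribution (`IsDistributionOf.ae_eq`), so every
slice vanishes a.e. and `not_isMaximalBesovMildSolution_of_forall_ae_eq_zero` applies.
[cite: GKP2016, §2.5] -/
theorem IsBesovMildSolutionOn.not_isMaximalBesovMildSolution_of_forall_eq_zero
    (hu : IsBesovMildSolutionOn s p q T ν u U) (h0 : ∀ t ∈ Ico 0 T, U t = 0) :
    ¬ IsMaximalBesovMildSolution s p q T ν u U :=
  not_isMaximalBesovMildSolution_of_forall_ae_eq_zero fun t ht =>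
    (hu.isDistributionOf t ht).ae_eq (by rw [h0 t ht]; exact isDistributionOf_zero)

/-- **The initial distribution of a Besov-continuous family vanishing on `(0, T)` vanishes.**
If `U ∈ C([0,T); Ḃ^s_{p,q})` (`-2 < s < 0`, `1 ≤ q`, `0 < T`) and `U t = 0` for `0 < t < T`, then
`U 0 = 0`: the pairings `t ↦ ⟨U t, θ⟩` are continuous on `[0, T)`
(`ContinuousInHomBesovOn.tendsto_apply`, BCD Prop. 2.27) and vanish on `(0, T)`. [folklore] -/
theorem ContinuousInHomBesovOn.apply_zero_eq_zero_of_forall_Ioo (hs0 : s < 0) (hs2 : -2 < s)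
    (hq : 1 ≤ q) (hT : 0 < T) (hU : ContinuousInHomBesovOn (Ico 0 T) s p q U)
    (h0 : ∀ t ∈ Ioo 0 T, U t = 0) : U 0 = 0 := by
  refine DFunLike.ext _ _ fun θ => ?_
  have hlim : Tendsto (fun t => U t θ) (𝓝[Ioo 0 T] 0) (𝓝 (U 0 θ)) :=
    (hU.tendsto_apply hs0 hs2 hq θ ⟨le_rfl, hT⟩).mono_left (nhdsWithin_mono _ Ioo_subset_Ico_self)
  have hzero : Tendsto (fun t => U t θ) (𝓝[Ioo 0 T] 0) (𝓝 0) := by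
    refine tendsto_const_nhds.congr' ?_
    filter_upwards [self_mem_nhdsWithin] with t ht
    rw [h0 t ht]
    rfl
  haveI : (𝓝[Ioo 0 T] (0 : ℝ)).NeBot := left_nhdsWithin_Ioo_neBot hT
  simpa using tendsto_nhds_unique hlim hzero

/-- **Endgame of GKP §2.5 from the open interval.** If `(u, U)` is a Besov mild solution on
`[0, T)`, `0 < T`, in a class `Ḃ^s_{p,q}` with `-2 < s < 0`, `1 ≤ q` (e.g. GKP's
`s_p = -1 + 3/p`, `3 < p < ∞`, `q = p`), and every slice `u t`, `0 < t < T`, vanishes a.e. — the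
output of backward uniqueness and unique continuation in the printed proof, which reach every
positive time but not `t = 0` — then `(u, U)` is not maximal with lifespan `T`: the distributions
vanish on `(0, T)` (`IsDistributionOf.congr_ae`, `IsDistributionOf.unique`), hence at `t = 0` by
continuity in `Ḃ^s_{p,q}` (`ContinuousInHomBesovOn.apply_zero_eq_zero_of_forall_Ioo`), and
`IsBesovMildSolutionOn.not_isMaximalBesovMildSolution_of_forall_eq_zero` applies.
[cite: GKP2016, §2.5] -/
theorem IsBesovMildSolutionOn.not_isMaximalBesovMildSolution_of_forall_Ioo_ae_eq_zero
    (hu : IsBesovMildSolutionOn s p q T ν u U) (hs0 : s < 0) (hs2 : -2 < s) (hq : 1 ≤ q)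
    (hT : 0 < T) (h0 : ∀ t ∈ Ioo 0 T, u t =ᵐ[volume] 0) :
    ¬ IsMaximalBesovMildSolution s p q T ν u U := by
  have hU0 : ∀ t ∈ Ioo 0 T, U t = 0 := fun t ht =>
    ((hu.isDistributionOf t ⟨ht.1.le, ht.2⟩).congr_ae (h0 t ht)).unique isDistributionOf_zero
  have hU00 : U 0 = 0 :=
    hu.continuousInHomBesovOn.apply_zero_eq_zero_of_forall_Ioo hs0 hs2 hq hT hU0
  refine hu.not_isMaximalBesovMildSolution_of_forall_eq_zero fun t ht => ?_
  rcases ht.1.eq_or_lt with h | h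
  · rw [← h]; exact hU00
  · exact hU0 t ⟨h, ht.2⟩

end Zero

/-! ## Step C of §2.5: the weak-* limit identifies the pointwise limit -/

section WeakStarLimit

variable {ι : Type*} [Fintype ι] {E : Type*} [NormedAddCommGroup E] [InnerProductSpace ℝ E]
  [FiniteDimensional ℝ E] [MeasurableSpace E] [BorelSpace E]

/-- **"`NS(u₀)(T*)` is well-defined outside of `K`, and hence `NS(u₀)(x, T*) ≡ 0` for all
`x ∈ Kᶜ`" (GKP 2016, §2.5), abstract form.** Let `U i → 0` in `𝓢'(E, ℂ^ι)` (weak-* = pointwise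
topology) along a non-trivial filter `l`, let `U i` be, eventually along `l`, the tempered
distribution of the field `u i : E → ℝ^ι`, and let the fields converge *inside an open set `Ω`*
to a locally integrable `w` in the weakest useful sense: `∫ g • u i → ∫ g • w` for every smooth
real `g` compactly supported in `Ω`. Then `w = 0` a.e. on `Ω`. Proof: for such `g`, the complex
test function `θ = g` is Schwartz, `⟨U i, θ⟩ = complexify (∫ g • u i)` eventually, and
`⟨U i, θ⟩ → 0`; so `complexify (∫ g • w) = 0`, i.e. `∫ g • w = 0`, and Mathlib's
`IsOpen.ae_eq_zero_of_integral_contDiff_smul_eq_zero` concludes. [cite: GKP2016, §2.5] -/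
theorem ae_eq_zero_on_of_tendsto_temperedDistribution_zero {α : Type*} {l : Filter α} [l.NeBot]
    {u : α → E → EuclideanSpace ℝ ι} {U : α → 𝓢'(E, EuclideanSpace ℂ ι)}
    {w : E → EuclideanSpace ℝ ι} {Ω : Set E} (hΩ : IsOpen Ω)
    (hU : ∀ᶠ i in l, IsDistributionOf (u i) (U i)) (hlim : Tendsto U l (𝓝 0))
    (hw : LocallyIntegrableOn w Ω volume)
    (hconv : ∀ g : E → ℝ, ContDiff ℝ ((⊤ : ℕ∞) : WithTop ℕ∞) g → HasCompactSupport g →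
      tsupport g ⊆ Ω →
      Tendsto (fun i => ∫ x, g x • u i x) l (𝓝 (∫ x, g x • w x))) :
    ∀ᵐ x ∂(volume : Measure E), x ∈ Ω → w x = 0 := by
  refine hΩ.ae_eq_zero_of_integral_contDiff_smul_eq_zero hw fun g hg hgs hgΩ => ?_
  -- the complex test function `θ = g`
  have hcs : HasCompactSupport fun y => ((g y : ℝ) : ℂ) := hgs.comp_left Complex.ofReal_zero
  have hcd : ContDiff ℝ ((⊤ : ℕ∞) : WithTop ℕ∞) fun y => ((g y : ℝ) : ℂ) :=
    Complex.ofRealCLM.contDiff.comp hg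
  set θ : 𝓢(E, ℂ) := hcs.toSchwartzMap hcd with hθ
  have hθ_apply : ∀ y, θ y = ((g y : ℝ) : ℂ) := fun y => rfl
  -- eventually `⟨U i, θ⟩ = complexify (∫ g • u i)`
  have hrepr : ∀ᶠ i in l,
      U i θ = FunctionSpaces.EuclideanSpace.complexify (∫ y, g y • u i y) := by
    filter_upwards [hU] with i hi
    rw [(hi θ).2]
    have e : (fun y => θ y • FunctionSpaces.EuclideanSpace.complexify (u i y)) =
        fun y => FunctionSpaces.EuclideanSpace.complexify (g y • u i y) := by
      funext y
      rw [hθ_apply, map_smul, Complex.coe_smul]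
    rw [e]
    exact (FunctionSpaces.EuclideanSpace.complexify (ι := ι)).toContinuousLinearMap
      |>.integral_comp_comm
        (hi.locallyIntegrable.integrable_smul_left_of_hasCompactSupport hg.continuous hgs)
  -- `⟨U i, θ⟩ → 0`
  have h0 : Tendsto (fun i => U i θ) l (𝓝 0) := by
    have h := (PointwiseConvergenceCLM.tendsto_iff_forall_tendsto.1 hlim) θ
    simpa using h
  -- hence `complexify (∫ g • u i) → 0` and `→ complexify (∫ g • w)`
  have h1 : Tendsto (fun i => FunctionSpaces.EuclideanSpace.complexify (∫ y, g y • u i y)) l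
      (𝓝 0) :=
    h0.congr' hrepr
  have h2 : Tendsto (fun i => FunctionSpaces.EuclideanSpace.complexify (∫ y, g y • u i y)) l
      (𝓝 (FunctionSpaces.EuclideanSpace.complexify (∫ y, g y • w y))) :=
    (FunctionSpaces.EuclideanSpace.continuous_complexify.tendsto _).comp (hconv g hg hgs hgΩ)
  have h3 : FunctionSpaces.EuclideanSpace.complexify (ι := ι) (∫ y, g y • w y) =
      FunctionSpaces.EuclideanSpace.complexify (ι := ι) 0 := by
    rw [map_zero]
    exact tendsto_nhds_unique h2 h1
  exact FunctionSpaces.EuclideanSpace.complexify_injective h3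

/-- **Step C of GKP §2.5 for the slices of a Besov mild solution.** Let `(u, U)` be a Besov mild
solution on `[0, T)`, `0 < T`, with `U t → 0` in `𝓢'` as `t ↑ T` (the hypothesis of Prop. 2.3),
and suppose that on an open `Ω ⊆ ℝ^ι` the slices have a limit `w` at `t = T` in the sense
`∫ g • u t → ∫ g • w` (`t ↑ T`) for every smooth `g` compactly supported in `Ω`, `w` locally
integrable on `Ω` — as is the case when `u` is smooth and bounded with bounded derivatives on
`Ω × (T - ε, T)` ("smooth at and near time `T*` outside of some large compact set `K`", by
ε-regularity). Then `w = 0` a.e. on `Ω`: "`NS(u₀)(x, T*) ≡ 0` for all `x ∈ Kᶜ`".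
[cite: GKP2016, §2.5] -/
theorem IsBesovMildSolutionOn.limit_ae_eq_zero_on {s : ℝ} {p q : ℝ≥0∞} [Fact (1 ≤ p)] {T ν : ℝ}
    {u : ℝ → EuclideanSpace ℝ ι → EuclideanSpace ℝ ι}
    {U : ℝ → 𝓢'(EuclideanSpace ℝ ι, EuclideanSpace ℂ ι)}
    (hu : IsBesovMildSolutionOn s p q T ν u U) (hT : 0 < T) (hlim : Tendsto U (𝓝[<] T) (𝓝 0))
    {Ω : Set (EuclideanSpace ℝ ι)} (hΩ : IsOpen Ω) {w : EuclideanSpace ℝ ι → EuclideanSpace ℝ ι}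
    (hw : LocallyIntegrableOn w Ω volume)
    (hconv : ∀ g : EuclideanSpace ℝ ι → ℝ, ContDiff ℝ ((⊤ : ℕ∞) : WithTop ℕ∞) g →
      HasCompactSupport g → tsupport g ⊆ Ω →
      Tendsto (fun t => ∫ x, g x • u t x) (𝓝[<] T) (𝓝 (∫ x, g x • w x))) :
    ∀ᵐ x ∂(volume : Measure (EuclideanSpace ℝ ι)), x ∈ Ω → w x = 0 := by
  have hev : ∀ᶠ t in 𝓝[<] T, IsDistributionOf (u t) (U t) := by
    filter_upwards [Ico_mem_nhdsLT hT] with t ht using hu.isDistributionOf t ht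
  exact ae_eq_zero_on_of_tendsto_temperedDistribution_zero hΩ hev hlim hw hconv

/-- **Integral convergence against tests from locally uniform convergence.** If the fields `u i`
are (eventually) locally integrable and converge locally uniformly on an open `Ω` to `w`, locally
integrable on `Ω`, then `∫ g • u i → ∫ g • w` for every continuous `g` compactly supported in `Ω`
(the convergence is uniform on the compact `tsupport g ⊆ Ω`, and
`‖∫ g • (u i - w)‖ ≤ (∫ ‖g‖) · sup_{tsupport g} ‖u i - w‖`). This is the form in which Step C of
GKP §2.5 is fed: near `T*` and outside a compact `K` the solution is smooth with bounded
derivatives (ε-regularity), hence converges locally uniformly on `Kᶜ` as `t ↑ T*`. [folklore] -/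
theorem tendsto_integral_smul_of_tendstoLocallyUniformlyOn {α : Type*} {l : Filter α}
    {u : α → E → EuclideanSpace ℝ ι} {w : E → EuclideanSpace ℝ ι} {Ω : Set E} (hΩ : IsOpen Ω)
    (hu : ∀ᶠ i in l, LocallyIntegrable (u i) volume) (hw : LocallyIntegrableOn w Ω volume)
    (hconv : TendstoLocallyUniformlyOn u w l Ω) {g : E → ℝ} (hg : Continuous g)
    (hgs : HasCompactSupport g) (hgΩ : tsupport g ⊆ Ω) :
    Tendsto (fun i => ∫ x, g x • u i x) l (𝓝 (∫ x, g x • w x)) := by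
  set K := tsupport g with hKdef
  have hK : IsCompact K := hgs
  have hunif : TendstoUniformlyOn u w l K :=
    (tendstoLocallyUniformlyOn_iff_forall_isCompact hΩ).1 hconv K hgΩ hK
  -- `g • w` is integrable: it vanishes off the compact `K ⊆ Ω`, on which `w` is integrable
  have hgw : Integrable (fun x => g x • w x) volume := by
    have e : K.indicator (fun x => g x • w x) = fun x => g x • w x := by
      apply indicator_eq_self.2
      apply support_subset_iff'.2
      intro x hx
      simp [image_eq_zero_of_notMem_tsupport hx]
    rw [← e, indicator_smul]
    change Integrable (g • K.indicator w) volume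
    exact Integrable.smul_of_top_right
      ((integrable_indicator_iff hK.measurableSet).2 (hw.integrableOn_compact_subset hgΩ hK))
      (hg.memLp_top_of_hasCompactSupport hgs _)
  have hgi : Integrable (fun x => ‖g x‖) volume := (hg.integrable_of_hasCompactSupport hgs).norm
  set G : ℝ := ∫ x, ‖g x‖ with hG
  have hG0 : 0 ≤ G := integral_nonneg fun x => norm_nonneg _
  rw [Metric.tendsto_nhds]
  intro ε hε
  obtain ⟨δ, hδ0, hδ⟩ : ∃ δ : ℝ, 0 < δ ∧ G * δ < ε :=
    ⟨ε / (G + 1), div_pos hε (by linarith), by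
      rw [mul_div_assoc', div_lt_iff₀ (by linarith : (0 : ℝ) < G + 1)]; nlinarith⟩
  filter_upwards [hu, Metric.tendstoUniformlyOn_iff.1 hunif δ hδ0] with i hui hi
  have hgu : Integrable (fun x => g x • u i x) volume :=
    hui.integrable_smul_left_of_hasCompactSupport hg hgs
  rw [dist_eq_norm, ← integral_sub hgu hgw]
  have hpt : ∀ x, ‖g x • u i x - g x • w x‖ ≤ ‖g x‖ * δ := by
    intro x
    by_cases hx : x ∈ K
    · rw [← smul_sub, norm_smul]
      refine mul_le_mul_of_nonneg_left ?_ (norm_nonneg _)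
      rw [← dist_eq_norm, dist_comm]
      exact (hi x hx).le
    · have h0 : g x = 0 := image_eq_zero_of_notMem_tsupport hx
      simp [h0]
  calc ‖∫ x, (g x • u i x - g x • w x)‖ ≤ ∫ x, ‖g x‖ * δ :=
        norm_integral_le_of_norm_le (hgi.mul_const δ) (Eventually.of_forall hpt)
    _ = G * δ := by rw [integral_mul_const]
    _ < ε := hδ

/-- **Step C of GKP §2.5 with locally uniform convergence: the limit vanishes identically.** If
`U i → 0` in `𝓢'(E, ℂ^ι)` along a non-trivial filter, `U i` is eventually the distribution of the
field `u i`, and `u i → w` locally uniformly on an open `Ω` with `w` continuous on `Ω`, then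
`w ≡ 0` on `Ω` ("`NS(u₀)(T*)` is well-defined outside of `K`, and hence `NS(u₀)(x, T*) ≡ 0` for
all `x ∈ Kᶜ`"): a.e. by `ae_eq_zero_on_of_tendsto_temperedDistribution_zero` and
`tendsto_integral_smul_of_tendstoLocallyUniformlyOn`, everywhere by continuity
(`Measure.eqOn_open_of_ae_eq`). [cite: GKP2016, §2.5] -/
theorem eqOn_zero_of_tendsto_temperedDistribution_zero {α : Type*} {l : Filter α} [l.NeBot]
    {u : α → E → EuclideanSpace ℝ ι} {U : α → 𝓢'(E, EuclideanSpace ℂ ι)}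
    {w : E → EuclideanSpace ℝ ι} {Ω : Set E} (hΩ : IsOpen Ω)
    (hU : ∀ᶠ i in l, IsDistributionOf (u i) (U i)) (hlim : Tendsto U l (𝓝 0))
    (hw : ContinuousOn w Ω) (hconv : TendstoLocallyUniformlyOn u w l Ω) : EqOn w 0 Ω := by
  have hwi : LocallyIntegrableOn w Ω volume := hw.locallyIntegrableOn hΩ.measurableSet
  have hae := ae_eq_zero_on_of_tendsto_temperedDistribution_zero hΩ hU hlim hwi
    fun g hg hgs hgΩ => tendsto_integral_smul_of_tendstoLocallyUniformlyOn hΩ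
      (hU.mono fun i hi => hi.locallyIntegrable) hwi hconv hg.continuous hgs hgΩ
  refine Measure.eqOn_open_of_ae_eq (μ := (volume : Measure E)) ?_ hΩ hw continuousOn_const
  exact (ae_restrict_iff' hΩ.measurableSet).2 hae

/-- **Step C of GKP §2.5 for the slices of a Besov mild solution, locally uniform form.** Let
`(u, U)` be a Besov mild solution on `[0, T)`, `0 < T`, with `U t → 0` in `𝓢'` as `t ↑ T`, and let
the slices converge locally uniformly on an open `Ω` to a field `w` continuous on `Ω` as `t ↑ T`
(as they do outside a large compact set once ε-regularity has made `u` smooth and bounded with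
bounded derivatives there up to `t = T`). Then `w ≡ 0` on `Ω`. [cite: GKP2016, §2.5] -/
theorem IsBesovMildSolutionOn.limit_eqOn_zero {s : ℝ} {p q : ℝ≥0∞} [Fact (1 ≤ p)] {T ν : ℝ}
    {u : ℝ → EuclideanSpace ℝ ι → EuclideanSpace ℝ ι}
    {U : ℝ → 𝓢'(EuclideanSpace ℝ ι, EuclideanSpace ℂ ι)}
    (hu : IsBesovMildSolutionOn s p q T ν u U) (hT : 0 < T) (hlim : Tendsto U (𝓝[<] T) (𝓝 0))
    {Ω : Set (EuclideanSpace ℝ ι)} (hΩ : IsOpen Ω) {w : EuclideanSpace ℝ ι → EuclideanSpace ℝ ι}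
    (hw : ContinuousOn w Ω) (hconv : TendstoLocallyUniformlyOn u w (𝓝[<] T) Ω) : EqOn w 0 Ω :=
  have hev : ∀ᶠ t in 𝓝[<] T, IsDistributionOf (u t) (U t) := by
    filter_upwards [Ico_mem_nhdsLT hT] with t ht using hu.isDistributionOf t ht
  eqOn_zero_of_tendsto_temperedDistribution_zero hΩ hev hlim hw hconv

end WeakStarLimit

/-! ## Step E of §2.5: a bounded irrotational incompressible slice in a Besov class vanishes -/

section ConstantExclusion

open scoped FourierTransform

variable {ι : Type*} [Fintype ι] {E : Type*} [NormedAddCommGroup E] [InnerProductSpace ℝ E]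
  [FiniteDimensional ℝ E] [MeasurableSpace E] [BorelSpace E]
  {F' : Type*} [NormedAddCommGroup F'] [NormedSpace ℂ F'] [CompleteSpace F']

/-- `∫ 𝓕 h = h(0)` for a Schwartz function `h` (Fourier inversion at the origin:
`(𝓕⁻ g)(0) = ∫ g`). [folklore] -/
theorem integral_fourier_eq_apply_zero (h : 𝓢(E, F')) : ∫ x, (𝓕 h) x = h 0 := by
  have h1 : ((𝓕⁻ (𝓕 h) : 𝓢(E, F')) : E → F') 0 = ∫ x, (𝓕 h) x := by
    rw [SchwartzMap.fourierInv_coe, Real.fourierInv_eq]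
    simp [SchwartzMap.fourier_coe]
  rw [← h1, FourierTransform.fourierInv_fourier_eq]

/-- **The low-frequency cut-offs fix the constants**: if `U` is the tempered distribution of a
constant field `x ↦ c`, then `Ṡ_j U = U` for every `j` (`𝓕 U = c δ₀` and `χ(2^{-j} · 0) = 1`;
here through the transpose: `⟨Ṡ_j U, θ⟩ = ⟨U, 𝓕(χ_j 𝓕⁻θ)⟩ = (∫ 𝓕(χ_j 𝓕⁻θ)) • c =
(χ_j(0) (𝓕⁻θ)(0)) • c = (∫ θ) • c = ⟨U, θ⟩`). [folklore] -/
theorem lowFreqCutoff_eq_self_of_isDistributionOf_const {c : EuclideanSpace ℝ ι}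
    {U : 𝓢'(E, EuclideanSpace ℂ ι)} (hU : IsDistributionOf (fun _ : E => c) U) (j : ℤ) :
    FunctionSpaces.lowFreqCutoff j U = U := by
  refine DFunLike.ext _ _ fun θ => ?_
  have hrepr : ∀ ψ : 𝓢(E, ℂ), U ψ = (∫ x, ψ x) • FunctionSpaces.EuclideanSpace.complexify c :=
    fun ψ => by rw [(hU ψ).2, integral_smul_const]
  rw [FunctionSpaces.lowFreqCutoff_apply, TemperedDistribution.fourierMultiplierCLM_apply_apply,
    hrepr, hrepr, integral_fourier_eq_apply_zero,
    SchwartzMap.smulLeftCLM_apply_apply (FunctionSpaces.hasTemperateGrowth_lowFreqSymbol j)]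
  have h0 : FunctionSpaces.lowFreqSymbol (E := E) j 0 = 1 := by
    simp [FunctionSpaces.lowFreqSymbol, FunctionSpaces.dyadicCutoff_apply_of_norm_le_one]
  have h1 : ((𝓕⁻ θ : 𝓢(E, ℂ)) : E → ℂ) 0 = ∫ x, θ x := by
    rw [SchwartzMap.fourierInv_coe, Real.fourierInv_eq]
    simp
  rw [h0, one_smul, h1]

/-- **A constant field whose distribution is realised (`Ṡ_j U → 0` as `j → -∞`) vanishes**: the
realisation clause of `MemHomBesov` (BCD Def. 1.26, the space `𝓢'_h`) excludes the non-zero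
constants, all of whose Littlewood–Paley blocks vanish. Proof: `Ṡ_j U = U`
(`lowFreqCutoff_eq_self_of_isDistributionOf_const`), so the constant sequence `U` tends to `0`,
`U = 0`, and a field with the zero distribution vanishes a.e. (`IsDistributionOf.ae_eq`).
[cite: BahouriCheminDanchin2011, Def. 1.26] -/
theorem eq_zero_of_isDistributionOf_const_of_tendsto_lowFreqCutoff {c : EuclideanSpace ℝ ι}
    {U : 𝓢'(E, EuclideanSpace ℂ ι)} (hU : IsDistributionOf (fun _ : E => c) U)
    (hreal : Tendsto (fun j : ℤ => FunctionSpaces.lowFreqCutoff j U) atBot (𝓝 0)) : c = 0 := by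
  have hU0 : U = 0 := by
    have h : Tendsto (fun _ : ℤ => U) atBot (𝓝 0) :=
      hreal.congr fun j => lowFreqCutoff_eq_self_of_isDistributionOf_const hU j
    exact tendsto_nhds_unique tendsto_const_nhds h
  rw [hU0] at hU
  have hae : (fun _ : E => c) =ᵐ[volume] (0 : E → EuclideanSpace ℝ ι) :=
    hU.ae_eq isDistributionOf_zero
  obtain ⟨x, hx⟩ := hae.exists
  simpa using hx

/-- The same for membership in a homogeneous Besov space: a constant field whose distribution lies
in some `Ḃ^s_{p,q}` (with the realisation condition built into `MemHomBesov`) vanishes.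
[cite: BahouriCheminDanchin2011, Def. 1.26] -/
theorem eq_zero_of_isDistributionOf_const_of_memHomBesov {c : EuclideanSpace ℝ ι}
    {U : 𝓢'(E, EuclideanSpace ℂ ι)} (hU : IsDistributionOf (fun _ : E => c) U) {s : ℝ}
    {p q : ℝ≥0∞} [Fact (1 ≤ p)] (hB : FunctionSpaces.MemHomBesov s p q U) : c = 0 :=
  eq_zero_of_isDistributionOf_const_of_tendsto_lowFreqCutoff hU hB.2

/-- **Step E of GKP §2.5: "backward uniqueness and unique continuation for `ω = ∇ ∧ NS(u₀)` imply
`NS(u₀)(·, t) ≡ 0`".** A bounded `C²` slice `V : ℝ³ → ℝ³` with `curl V = 0` and `div V = 0`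
whose tempered distribution lies in a homogeneous Besov space `Ḃ^s_{p,q}` (as the slices of a Besov
mild solution do, `IsBesovMildSolutionOn.continuousInHomBesovOn`) vanishes identically: it is
constant by Liouville's theorem for the system `curl V = 0`, `div V = 0`
(`eq_of_curl_eq_zero_of_isDivFree_of_bounded`, KNSS 2009 Lemma 3.1), and realised Besov
distributions contain no non-zero constants (`eq_zero_of_isDistributionOf_const_of_memHomBesov`).
[cite: GKP2016, §2.5] -/
theorem eq_zero_of_curl_eq_zero_of_isDivFree_of_memHomBesov
    {V : EuclideanSpace ℝ (Fin 3) → EuclideanSpace ℝ (Fin 3)} (hV : ContDiff ℝ 2 V)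
    (hcurl : ∀ x, curl V x = 0) (hdiv : VectorCalculus.IsDivFree V) {M : ℝ} (hM : ∀ x, ‖V x‖ ≤ M)
    {U : 𝓢'(EuclideanSpace ℝ (Fin 3), EuclideanSpace ℂ (Fin 3))} (hU : IsDistributionOf V U)
    {s : ℝ} {p q : ℝ≥0∞} [Fact (1 ≤ p)] (hB : FunctionSpaces.MemHomBesov s p q U) : V = 0 := by
  have hconst : V = fun _ => V 0 :=
    funext fun x => eq_of_curl_eq_zero_of_isDivFree_of_bounded hV hcurl hdiv hM x 0
  rw [hconst] at hU ⊢
  have h0 : V 0 = 0 := eq_zero_of_isDistributionOf_const_of_memHomBesov hU hB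
  rw [h0]
  rfl

end ConstantExclusion

/-! ## Prop. 2.3 in the tree's rendering = the printed one over GKP's class + the identification -/

section Prop23

/-- **Prop. 2.3 in the tree's rendering = Prop. 2.3 over GKP's class `𝓛^{1:∞}_p[T' < T]` + the
identification of the tree's class with `NS(u₀)`.** Hypothesis `hP` is GKP 2016, Prop. 2.3 ("if
`u₀ ∈ Ḃ^{s_p}_{p,p}` with
`sup_{t ∈ [0,T*(u₀))} ‖NS(u₀)(t)‖_{Ḃ^{s_p}_{p,p}} < ∞` and `NS(u₀)(t) → 0` in `𝓢'` as `t ↗ T*(u₀)`,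
then `T*(u₀) = ∞`") transported to Gallagher–Koch–Planchon's own solution class, in the
conventions of `gkp_exists_criticalElement_of_pathSpace` and
`gkp_criticalElement_tendsto_zero_of_pathSpace`: with "GKP solution on `[0, T)`" = Besov mild
solution of the class `(s_p, p, p)` lying in `𝓛^{1:∞}_p[T' < T]` (`MemGKPPathSpace p p T U`), *for
`p = 3·2^k - 2`, `k ≥ 2`, and `ν > 0`, a GKP solution `(u, U)` on `[0, T)`, `0 < T < ∞`, with
`sup_{[0,T)} ‖U t‖_{Ḃ^{s_p}_{p,p}} < ∞` and `U t → 0` in `𝓢'(ℝ³, ℂ³)` as `t → T⁻` extends to a GKP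
solution on a longer interval* (i.e. `T < T*(u₀)` for every such `T`: `T*(u₀) = ∞`). Hypothesis
`hId` is the standing identification of `CriticalRegularity.lean` in the form used by the sibling
reductions — every `IsBesovMildSolutionOn` solution lies in GKP's path space — which is **not** a
published result and is not asserted here (`GKPRegularityPersistence.lean`, module docstring).
Together they give Prop. 2.3 in the tree's rendering — the statement of the former named fact
`gkp_rigidity` (merged back into the proof obligation of `gkp_besov_blowup`, see the module
docstring), verbatim, i.e. the hypothesis `h3` of `gkp_besov_blowup_of_gkp`: for GKP exponents `p`
and `ν > 0`, a Besov mild solution of the tree's class `(s_p, p, p)` on `[0, T)`, `0 < T`, with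
bounded critical norm and `U t → 0` in `𝓢'` as `t → T⁻` is not maximal in the tree's class — since
such a solution is a GKP solution by `hId`, `hP` extends it inside GKP's class, and an extension in
GKP's class is in particular an extension in the tree's class, against
`IsMaximalBesovMildSolution.not_extendable`. [cite: GKP2016, Prop. 2.3] -/
theorem gkp_rigidity_of_pathSpace
    (hP : ∀ ⦃ν : ℝ⦄, 0 < ν → ∀ ⦃p : ℝ≥0∞⦄ [Fact (1 ≤ p)], IsGKPExponent p →
      ∀ ⦃T : ℝ⦄ ⦃u : ℝ → EuclideanSpace ℝ (Fin 3) → EuclideanSpace ℝ (Fin 3)⦄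
        ⦃U : ℝ → 𝓢'(EuclideanSpace ℝ (Fin 3), EuclideanSpace ℂ (Fin 3))⦄, 0 < T →
        IsBesovMildSolutionOn (-1 + 3 / p.toReal) p p T ν u U → MemGKPPathSpace p p T U →
        ⨆ t ∈ Ico 0 T, FunctionSpaces.eHomBesovNorm (-1 + 3 / p.toReal) p p (U t) < ∞ →
        Tendsto U (𝓝[<] T) (𝓝 0) →
        ∃ T' > T, ∃ (v : ℝ → EuclideanSpace ℝ (Fin 3) → EuclideanSpace ℝ (Fin 3))
          (V : ℝ → 𝓢'(EuclideanSpace ℝ (Fin 3), EuclideanSpace ℂ (Fin 3))),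
          (IsBesovMildSolutionOn (-1 + 3 / p.toReal) p p T' ν v V ∧ MemGKPPathSpace p p T' V) ∧
            ∀ t ∈ Ico 0 T, v t =ᵐ[volume] u t)
    (hId : ∀ ⦃ν : ℝ⦄, 0 < ν → ∀ ⦃p q : ℝ≥0∞⦄ [Fact (1 ≤ p)], 3 < p → p < ∞ → 3 < q → q < ∞ →
      ∀ ⦃T : ℝ⦄, 0 < T → ∀ ⦃u : ℝ → EuclideanSpace ℝ (Fin 3) → EuclideanSpace ℝ (Fin 3)⦄
        ⦃U : ℝ → 𝓢'(EuclideanSpace ℝ (Fin 3), EuclideanSpace ℂ (Fin 3))⦄,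
        IsBesovMildSolutionOn (-1 + 3 / p.toReal) p q T ν u U → MemGKPPathSpace p q T U) :
    ∀ {ν : ℝ}, 0 < ν → ∀ {p : ℝ≥0∞} [Fact (1 ≤ p)], IsGKPExponent p → ∀ {T : ℝ}, 0 < T →
      ∀ {u : ℝ → EuclideanSpace ℝ (Fin 3) → EuclideanSpace ℝ (Fin 3)}
        {U : ℝ → 𝓢'(EuclideanSpace ℝ (Fin 3), EuclideanSpace ℂ (Fin 3))},
      IsBesovMildSolutionOn (-1 + 3 / p.toReal) p p T ν u U →
      ⨆ t ∈ Ico 0 T, FunctionSpaces.eHomBesovNorm (-1 + 3 / p.toReal) p p (U t) < ∞ →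
      Tendsto U (𝓝[<] T) (𝓝 0) →
      ¬ IsMaximalBesovMildSolution (-1 + 3 / p.toReal) p p T ν u U := by
  intro ν hν p _ hp T hT u U hu hsup hlim hmax
  -- `(u, U)` is a GKP solution by the identification; Prop. 2.3 over GKP's class extends it
  obtain ⟨T', hT', v, V, ⟨hv, -⟩, hvu⟩ :=
    hP hν hp hT hu (hId hν hp.three_lt hp.lt_top hp.three_lt hp.lt_top hT hu) hsup hlim
  exact hmax.not_extendable ⟨T', hT', v, V, hv, hvu⟩

/-- **The two phrasings of Prop. 2.3 over GKP's class agree.** The faithful statement of GKP 2016,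
Prop. 2.3 in the bundled vocabulary of `GKPCriticalElements.lean` — the conclusion of
`gkp_rigidity_pathSpace_of_blowup_pathSpace`, the wanted named fact `gkp_rigidity_pathSpace`: *a GKP
solution
`(u, U)` on `[0, T)`, `0 < T` (`IsGKPSolutionOn p p T ν u U`), with bounded critical norm on
`[0, T)` and `U t → 0` in `𝓢'` as `t → T⁻` is not a maximal GKP solution with lifespan `T`* — is
equivalent
to the unbundled hypothesis `hP` of `gkp_rigidity_of_pathSpace` (*such a solution, given as
`IsBesovMildSolutionOn ∧ MemGKPPathSpace`, has a GKP extension past `T`*): a GKP solution that is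
not maximal has, by definition of `IsMaximalGKPSolution`, an extension in GKP's class, and
conversely (`isGKPSolutionOn_iff_memGKPPathSpace`, `isMaximalGKPSolution_iff_memGKPPathSpace`).
Both say "`T < T*(u₀)`", i.e. the printed "`T*(u₀) = ∞`" for finite `T`. [cite: GKP2016, Prop. 2.3] -/
theorem gkp_rigidity_pathSpace_iff_exists_extension :
    (∀ ⦃ν : ℝ⦄, 0 < ν → ∀ ⦃p : ℝ≥0∞⦄ [Fact (1 ≤ p)], IsGKPExponent p → ∀ ⦃T : ℝ⦄, 0 < T →
      ∀ ⦃u : ℝ → EuclideanSpace ℝ (Fin 3) → EuclideanSpace ℝ (Fin 3)⦄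
        ⦃U : ℝ → 𝓢'(EuclideanSpace ℝ (Fin 3), EuclideanSpace ℂ (Fin 3))⦄,
        IsGKPSolutionOn p p T ν u U →
        ⨆ t ∈ Ico 0 T, FunctionSpaces.eHomBesovNorm (-1 + 3 / p.toReal) p p (U t) < ∞ →
        Tendsto U (𝓝[<] T) (𝓝 0) → ¬ IsMaximalGKPSolution p p T ν u U) ↔
    ∀ ⦃ν : ℝ⦄, 0 < ν → ∀ ⦃p : ℝ≥0∞⦄ [Fact (1 ≤ p)], IsGKPExponent p →
      ∀ ⦃T : ℝ⦄ ⦃u : ℝ → EuclideanSpace ℝ (Fin 3) → EuclideanSpace ℝ (Fin 3)⦄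
        ⦃U : ℝ → 𝓢'(EuclideanSpace ℝ (Fin 3), EuclideanSpace ℂ (Fin 3))⦄, 0 < T →
        IsBesovMildSolutionOn (-1 + 3 / p.toReal) p p T ν u U → MemGKPPathSpace p p T U →
        ⨆ t ∈ Ico 0 T, FunctionSpaces.eHomBesovNorm (-1 + 3 / p.toReal) p p (U t) < ∞ →
        Tendsto U (𝓝[<] T) (𝓝 0) →
        ∃ T' > T, ∃ (v : ℝ → EuclideanSpace ℝ (Fin 3) → EuclideanSpace ℝ (Fin 3))
          (V : ℝ → 𝓢'(EuclideanSpace ℝ (Fin 3), EuclideanSpace ℂ (Fin 3))),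
          (IsBesovMildSolutionOn (-1 + 3 / p.toReal) p p T' ν v V ∧ MemGKPPathSpace p p T' V) ∧
            ∀ t ∈ Ico 0 T, v t =ᵐ[volume] u t := by
  constructor
  · intro h ν hν p _ hp T u U hT hu hU hsup hlim
    by_contra hne
    exact h hν hp hT (isGKPSolutionOn_iff_memGKPPathSpace.2 ⟨hu, hU⟩) hsup hlim
      (isMaximalGKPSolution_iff_memGKPPathSpace.2 ⟨hu, hU, hne⟩)
  · intro hP ν hν p _ hp T hT u U _ hsup hlim hmax
    obtain ⟨hu, hU, hne⟩ := isMaximalGKPSolution_iff_memGKPPathSpace.1 hmax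
    exact hne (hP hν hp hT hu hU hsup hlim)

end Prop23

/-! ## Theorem 1 (rendered) from the printed statements over GKP's class + the identification -/

section Theorem1

-- `linter.deprecated` is switched off for the next declaration only: it names the deprecated
-- (mis-stated, 2026-08-15) tree-class rendering(s) of GKP Thm. 1 (`gkp_besov_blowup`,
-- `CriticalRegularity.lean`), kept unchanged for their users until the faithful path-space forms
-- are vendored (see those files).
set_option linter.deprecated false in
/-- **GKP's Theorem 1 as rendered (`gkp_besov_blowup`) from the printed statements over GKP's
class.** Granted, over Gallagher–Koch–Planchon's own solution class `𝓛^{1:∞}[T' < T]`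
(`MemGKPPathSpace`): (1.9) with (1.6) (`h19`, the hypothesis `h` of
`gkp_regularity_persistence_of_pathSpace`), Prop. 2.1 (`hP1`, the hypothesis `hP` of
`gkp_exists_criticalElement_of_pathSpace`), Prop. 2.2 (`hP2`, the hypothesis `hP` of
`gkp_criticalElement_tendsto_zero_of_pathSpace`) and Prop. 2.3 (`hP3`, the hypothesis `hP` of
`gkp_rigidity_of_pathSpace`), together with the identification `hId` of the tree's class with
`NS(u₀)` (every `IsBesovMildSolutionOn` solution lies in GKP's path space — not a published result,
see `GKPRegularityPersistence.lean`), the blow-up of the critical Besov norm at a finite maximal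
time in the tree's rendering, `gkp_besov_blowup` (ns.S31), follows by the accepted assembly
`gkp_besov_blowup_of_gkp` (GKP 2016, §2.1: "Proof of Theorem 1. The proof follows by contradiction
… Propositions 2.1, 2.2 and 2.3 … (1.9)"). This theorem is the summary of the four audits: the
unprinted ingredient of the whole GKP route, as vendored, is exactly `hId`.
[cite: GKP2016, Thm. 1 and §2.1] -/
theorem gkp_besov_blowup_of_pathSpace
    (h19 : ∀ ⦃ν : ℝ⦄, 0 < ν → ∀ ⦃p q p' q' : ℝ≥0∞⦄ [Fact (1 ≤ p)] [Fact (1 ≤ p')], 3 < p → p < ∞ →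
      3 < q → q < ∞ → 3 < p' → p' < ∞ → 3 < q' → q' < ∞ → ∀ ⦃T : ℝ⦄, 0 < T →
      ∀ ⦃u : ℝ → EuclideanSpace ℝ (Fin 3) → EuclideanSpace ℝ (Fin 3)⦄
        ⦃U : ℝ → 𝓢'(EuclideanSpace ℝ (Fin 3), EuclideanSpace ℂ (Fin 3))⦄,
        IsBesovMildSolutionOn (-1 + 3 / p'.toReal) p' q' T ν u U → MemGKPPathSpace p' q' T U →
        FunctionSpaces.MemHomBesov (-1 + 3 / p.toReal) p q (U 0) →
        IsBesovMildSolutionOn (-1 + 3 / p.toReal) p q T ν u U ∧ MemGKPPathSpace p q T U)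
    (hP1 : ∀ ⦃ν : ℝ⦄, 0 < ν → ∀ ⦃p : ℝ≥0∞⦄ [Fact (1 ≤ p)], IsGKPExponent p →
      ∀ ⦃T₀ : ℝ⦄ ⦃u₀ : ℝ → EuclideanSpace ℝ (Fin 3) → EuclideanSpace ℝ (Fin 3)⦄
        ⦃U₀ : ℝ → 𝓢'(EuclideanSpace ℝ (Fin 3), EuclideanSpace ℂ (Fin 3))⦄, 0 < T₀ →
        IsBesovMildSolutionOn (-1 + 3 / p.toReal) p p T₀ ν u₀ U₀ → MemGKPPathSpace p p T₀ U₀ →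
        (¬ ∃ T' > T₀, ∃ (v : ℝ → EuclideanSpace ℝ (Fin 3) → EuclideanSpace ℝ (Fin 3))
            (V : ℝ → 𝓢'(EuclideanSpace ℝ (Fin 3), EuclideanSpace ℂ (Fin 3))),
            (IsBesovMildSolutionOn (-1 + 3 / p.toReal) p p T' ν v V ∧ MemGKPPathSpace p p T' V) ∧
              ∀ t ∈ Ico 0 T₀, v t =ᵐ[volume] u₀ t) →
        ⨆ t ∈ Ico 0 T₀, FunctionSpaces.eHomBesovNorm (-1 + 3 / p.toReal) p p (U₀ t) < ∞ →
        ∃ (T : ℝ) (u : ℝ → EuclideanSpace ℝ (Fin 3) → EuclideanSpace ℝ (Fin 3))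
          (U : ℝ → 𝓢'(EuclideanSpace ℝ (Fin 3), EuclideanSpace ℂ (Fin 3))), 0 < T ∧
          IsBesovMildSolutionOn (-1 + 3 / p.toReal) p p T ν u U ∧ MemGKPPathSpace p p T U ∧
          (¬ ∃ T' > T, ∃ (v : ℝ → EuclideanSpace ℝ (Fin 3) → EuclideanSpace ℝ (Fin 3))
              (V : ℝ → 𝓢'(EuclideanSpace ℝ (Fin 3), EuclideanSpace ℂ (Fin 3))),
              (IsBesovMildSolutionOn (-1 + 3 / p.toReal) p p T' ν v V ∧ MemGKPPathSpace p p T' V) ∧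
                ∀ t ∈ Ico 0 T, v t =ᵐ[volume] u t) ∧
          ∀ ⦃T₁ : ℝ⦄ ⦃u₁ : ℝ → EuclideanSpace ℝ (Fin 3) → EuclideanSpace ℝ (Fin 3)⦄
            ⦃U₁ : ℝ → 𝓢'(EuclideanSpace ℝ (Fin 3), EuclideanSpace ℂ (Fin 3))⦄, 0 < T₁ →
            IsBesovMildSolutionOn (-1 + 3 / p.toReal) p p T₁ ν u₁ U₁ → MemGKPPathSpace p p T₁ U₁ →
            (¬ ∃ T' > T₁, ∃ (v : ℝ → EuclideanSpace ℝ (Fin 3) → EuclideanSpace ℝ (Fin 3))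
                (V : ℝ → 𝓢'(EuclideanSpace ℝ (Fin 3), EuclideanSpace ℂ (Fin 3))),
                (IsBesovMildSolutionOn (-1 + 3 / p.toReal) p p T' ν v V ∧
                    MemGKPPathSpace p p T' V) ∧
                  ∀ t ∈ Ico 0 T₁, v t =ᵐ[volume] u₁ t) →
            ⨆ t ∈ Ico 0 T, FunctionSpaces.eHomBesovNorm (-1 + 3 / p.toReal) p p (U t) ≤
              ⨆ t ∈ Ico 0 T₁, FunctionSpaces.eHomBesovNorm (-1 + 3 / p.toReal) p p (U₁ t))
    (hP2 : ∀ ⦃ν : ℝ⦄, 0 < ν → ∀ ⦃p : ℝ≥0∞⦄ [Fact (1 ≤ p)], IsGKPExponent p →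
      ∀ ⦃T : ℝ⦄ ⦃u : ℝ → EuclideanSpace ℝ (Fin 3) → EuclideanSpace ℝ (Fin 3)⦄
        ⦃U : ℝ → 𝓢'(EuclideanSpace ℝ (Fin 3), EuclideanSpace ℂ (Fin 3))⦄, 0 < T →
        IsBesovMildSolutionOn (-1 + 3 / p.toReal) p p T ν u U → MemGKPPathSpace p p T U →
        (¬ ∃ T' > T, ∃ (v : ℝ → EuclideanSpace ℝ (Fin 3) → EuclideanSpace ℝ (Fin 3))
            (V : ℝ → 𝓢'(EuclideanSpace ℝ (Fin 3), EuclideanSpace ℂ (Fin 3))),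
            (IsBesovMildSolutionOn (-1 + 3 / p.toReal) p p T' ν v V ∧ MemGKPPathSpace p p T' V) ∧
              ∀ t ∈ Ico 0 T, v t =ᵐ[volume] u t) →
        ⨆ t ∈ Ico 0 T, FunctionSpaces.eHomBesovNorm (-1 + 3 / p.toReal) p p (U t) < ∞ →
        (∀ ⦃T₁ : ℝ⦄ ⦃u₁ : ℝ → EuclideanSpace ℝ (Fin 3) → EuclideanSpace ℝ (Fin 3)⦄
            ⦃U₁ : ℝ → 𝓢'(EuclideanSpace ℝ (Fin 3), EuclideanSpace ℂ (Fin 3))⦄, 0 < T₁ →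
            IsBesovMildSolutionOn (-1 + 3 / p.toReal) p p T₁ ν u₁ U₁ →
            MemGKPPathSpace p p T₁ U₁ →
            (¬ ∃ T' > T₁, ∃ (v : ℝ → EuclideanSpace ℝ (Fin 3) → EuclideanSpace ℝ (Fin 3))
                (V : ℝ → 𝓢'(EuclideanSpace ℝ (Fin 3), EuclideanSpace ℂ (Fin 3))),
                (IsBesovMildSolutionOn (-1 + 3 / p.toReal) p p T' ν v V ∧
                    MemGKPPathSpace p p T' V) ∧
                  ∀ t ∈ Ico 0 T₁, v t =ᵐ[volume] u₁ t) →
            ⨆ t ∈ Ico 0 T, FunctionSpaces.eHomBesovNorm (-1 + 3 / p.toReal) p p (U t) ≤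
              ⨆ t ∈ Ico 0 T₁, FunctionSpaces.eHomBesovNorm (-1 + 3 / p.toReal) p p (U₁ t)) →
        Tendsto U (𝓝[<] T) (𝓝 0))
    (hP3 : ∀ ⦃ν : ℝ⦄, 0 < ν → ∀ ⦃p : ℝ≥0∞⦄ [Fact (1 ≤ p)], IsGKPExponent p →
      ∀ ⦃T : ℝ⦄ ⦃u : ℝ → EuclideanSpace ℝ (Fin 3) → EuclideanSpace ℝ (Fin 3)⦄
        ⦃U : ℝ → 𝓢'(EuclideanSpace ℝ (Fin 3), EuclideanSpace ℂ (Fin 3))⦄, 0 < T →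
        IsBesovMildSolutionOn (-1 + 3 / p.toReal) p p T ν u U → MemGKPPathSpace p p T U →
        ⨆ t ∈ Ico 0 T, FunctionSpaces.eHomBesovNorm (-1 + 3 / p.toReal) p p (U t) < ∞ →
        Tendsto U (𝓝[<] T) (𝓝 0) →
        ∃ T' > T, ∃ (v : ℝ → EuclideanSpace ℝ (Fin 3) → EuclideanSpace ℝ (Fin 3))
          (V : ℝ → 𝓢'(EuclideanSpace ℝ (Fin 3), EuclideanSpace ℂ (Fin 3))),
          (IsBesovMildSolutionOn (-1 + 3 / p.toReal) p p T' ν v V ∧ MemGKPPathSpace p p T' V) ∧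
            ∀ t ∈ Ico 0 T, v t =ᵐ[volume] u t)
    (hId : ∀ ⦃ν : ℝ⦄, 0 < ν → ∀ ⦃p q : ℝ≥0∞⦄ [Fact (1 ≤ p)], 3 < p → p < ∞ → 3 < q → q < ∞ →
      ∀ ⦃T : ℝ⦄, 0 < T → ∀ ⦃u : ℝ → EuclideanSpace ℝ (Fin 3) → EuclideanSpace ℝ (Fin 3)⦄
        ⦃U : ℝ → 𝓢'(EuclideanSpace ℝ (Fin 3), EuclideanSpace ℂ (Fin 3))⦄,
        IsBesovMildSolutionOn (-1 + 3 / p.toReal) p q T ν u U → MemGKPPathSpace p q T U) :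
    gkp_besov_blowup :=
  gkp_besov_blowup_of_gkp (gkp_regularity_persistence_of_pathSpace h19 hId)
    (gkp_exists_criticalElement_of_pathSpace hP1 hId)
    (gkp_criticalElement_tendsto_zero_of_pathSpace hP2 hId) (gkp_rigidity_of_pathSpace hP3 hId)

end Theorem1

end Literature.Analysis.FluidPDE

end
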